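import Literature.Computability.Cryptography.ImpagliazzoLevinVerifier
import Literature.Computability.MetaComplexity.SchemeEncBricks
import HarnessLib

/-!
# Impagliazzo–Levin inversion, V: one round of the inverter is polynomial time

Towards the second efficiency statement of `ImpagliazzoLevinAnalysis.lean` (the inverter
`Params.inv` of `ImpagliazzoLevinOWF.lean` is PPT), this file puts **one round** of the inverter —
the candidate `Params.cand P Ad n b κ y sd` (the `n` majority answers, each over `128 n` runs of the
randomized heuristic scheme `A` on consecutive coin blocks) — into the tree's algebra of total
`FP` string functions. As in `AffineHashProgram.lean` / `YaoInvProgram.lean`, no machine is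
programmed: the round is a single clocked loop (`iterate_mem_FP`) over the `128 n · n` runs, fused
so that the runs of one query are consecutive and their majority is taken when the group ends:

* `rsFn A` — the randomized scheme `A(q; ρ)` as a total one-bit string function (normalise the
  scheme encoding, then run `A`; `rsFn_mem_FP` from `A.IsPolyTime schemeEnc encodeBool`);
* the size polynomials of the construction (`TmPoly`, `DnPoly`, `QPoly`, `RnPoly`, `roundsPoly`, …);
* the loop state `⟨x₁, ⟨1ᶜ, ⟨1^{cnt}, bits⟩⟩⟩`, `x₁ = ⟨1ⁿ, ⟨1ᵇ, ⟨1^κ, ⟨y, sd⟩⟩⟩⟩`, the round body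
  `rbody` (query `i = c / 128n`, run `t = c mod 128n`, count, and on the last run of a group append
  the majority bit), its value on well-formed states (`rbody_st1`), its semantics (`iterate_rbody`, `loopAt_eq`),
  its additive growth on every word (`length_rbody_le`), and **`candFn`** with
  `candFn ⟨1ⁿ, ⟨1ᵇ, ⟨1^κ, ⟨y, sd⟩⟩⟩⟩ = cand n b κ y sd` (`candFn_x1`) and `candFn ∈ FP`
  (`candFn_mem_FP`).

## References

* A. Bogdanov, L. Trevisan, *Average-Case Complexity*, ECCC TR06-073 (2006), proof of Claim 28
  (the search algorithm runs the scheme on every query) and Def. 2.12 (amplification by majority).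
* S. Arora, B. Barak, *Computational Complexity: A Modern Approach*, CUP 2009, §1.3, §1.4.1, §7.4.1.
-/

namespace Literature.Computability.Cryptography

namespace ImpagliazzoLevin

open _root_.Computability Polynomial Complexity Complexity.Plumb Complexity.Brick Complexity.OracleCompose
  Complexity.HashBricks MetaComplexity AffineStr AffineProg

/-! ### The randomized scheme as a total string function -/

/-- **The randomized scheme as a total one-bit string function**: on `⟨q, ρ⟩` it answers
`[A(decScheme q; ρ)]`, so that `rsFn A ⟨schemeEnc (z, N, m), ρ⟩ = [A.run (z, N, m) ρ]`. [folklore] -/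
def rsFn (A : RandAlg (List Bool × ℕ × ℕ) Bool) (w : List Bool) : List Bool := [A.run (decScheme (fstF w)) (sndF w)]

/-- Value of `rsFn` on well-formed words. [folklore] -/
@[simp] theorem rsFn_boolPair (A : RandAlg (List Bool × ℕ × ℕ) Bool) (q : List Bool × ℕ × ℕ) (ρ : List Bool) :
    rsFn A (boolPair (schemeEnc q) ρ) = [A.run q ρ] := by
  simp [rsFn]

/-- `rsFn A` is one-bit on every word. [folklore] -/
theorem oneBit_rsFn (A : RandAlg (List Bool × ℕ × ℕ) Bool) : OneBit (rsFn A) := fun _ => ⟨_, rfl⟩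

/-- `|rsFn A w| = 1`. [folklore] -/
@[simp] theorem length_rsFn (A : RandAlg (List Bool × ℕ × ℕ) Bool) (w : List Bool) : (rsFn A w).length = 1 := rfl

/-- **A polynomial-time randomized scheme is a total `FP` function**: normalise `⟨q, ρ⟩` to
`⟨schemeEnc (decScheme q), ρ⟩` (`normScheme`, `fanoutFn`), then run the machine of `A`
(`PolyTimeComputable.comp_holds`). [Arora–Barak 2009, §1.3] [folklore] -/
theorem rsFn_mem_FP {A : RandAlg (List Bool × ℕ × ℕ) Bool} (hA : A.IsPolyTime schemeEnc encodeBool) : rsFn A ∈ FP := by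
  have hnorm : PolyTimeComputable (id : List Bool → List Bool)
      (fun p : (List Bool × ℕ × ℕ) × List Bool => boolPair (schemeEnc p.1) p.2)
      (fun w => (decScheme (fstF w), sndF w)) := by
    obtain ⟨p, M, hM⟩ := fanoutFn_mem_FP (comp_mem_FP normScheme_mem_FP fstF_mem_FP) sndF_mem_FP
    refine ⟨p, M, fun w => ?_⟩
    have h := hM w
    simp only [fanoutFn_apply, Function.comp_apply, normScheme_apply, id] at h ⊢
    exact h
  obtain ⟨p, M, hM⟩ := PolyTimeComputable.comp_holds hA.1 hnorm
  exact ⟨p, M, fun w => hM w⟩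

/-! ### The size polynomials -/

/-- `128 n`. [folklore] -/
noncomputable def TmPoly : Polynomial ℕ := 128 * X
/-- `m₀(n) = 256 n (n+3)`. [folklore] -/
noncomputable def m0Poly : Polynomial ℕ := 256 * X * (X + 3)
/-- `J_pool(n)`. [folklore] -/
noncomputable def JpoolPoly : Polynomial ℕ := X ^ 2 * (X + 3) + (X + 3) * X

/-- `TmPoly` evaluates to `Tm`. [folklore] -/
@[simp] theorem eval_TmPoly (n : ℕ) : TmPoly.eval n = Tm n := by simp [TmPoly, Tm]
/-- `m0Poly` evaluates to `m0`. [folklore] -/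
@[simp] theorem eval_m0Poly (n : ℕ) : m0Poly.eval n = m0 n := by simp [m0Poly, m0]
/-- `JpoolPoly` evaluates to `Jpool`. [folklore] -/
@[simp] theorem eval_JpoolPoly (n : ℕ) : JpoolPoly.eval n = Jpool n := by simp [JpoolPoly, Jpool]

namespace Params

variable (P : Params) (Ad : Adv)

/-- `W(n)`. [folklore] -/
noncomputable def WPoly : Polynomial ℕ := P.LhPoly + LgPoly + (X + 4)
/-- `D(n)`. [folklore] -/
noncomputable def DnPoly : Polynomial ℕ := P.LhPoly + (LgPoly + ((X + 4) + JpoolPoly))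
/-- `N_max(n)`. [folklore] -/
noncomputable def NmaxPoly : Polynomial ℕ := P.WPoly + JpoolPoly + (X + 2)
/-- `s(n)`. [folklore] -/
noncomputable def slenPoly : Polynomial ℕ := 4 * P.NmaxPoly + m0Poly + 4
/-- `Q(n) = q_A(s(n))`. [folklore] -/
noncomputable def QPoly : Polynomial ℕ := Ad.qA.comp P.slenPoly
/-- `R(n) = D(n) + Q(n) · 128 n · n`. [folklore] -/
noncomputable def RnPoly : Polynomial ℕ := P.DnPoly + P.QPoly Ad * TmPoly * X
/-- `rounds(n) = (n+3)(Q(n)+1)`. [folklore] -/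
noncomputable def roundsPoly : Polynomial ℕ := (X + 3) * (P.QPoly Ad + 1)

/-- `WPoly` evaluates to `W`. [folklore] -/
@[simp] theorem eval_WPoly (n : ℕ) : P.WPoly.eval n = P.W n := by simp [WPoly, W]
/-- `DnPoly` evaluates to `Dn`. [folklore] -/
@[simp] theorem eval_DnPoly (n : ℕ) : P.DnPoly.eval n = P.Dn n := by simp [DnPoly, Dn]
/-- `NmaxPoly` evaluates to `Nmax`. [folklore] -/
@[simp] theorem eval_NmaxPoly (n : ℕ) : P.NmaxPoly.eval n = P.Nmax n := by simp [NmaxPoly, Nmax]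
/-- `slenPoly` evaluates to `slen`. [folklore] -/
@[simp] theorem eval_slenPoly (n : ℕ) : P.slenPoly.eval n = P.slen n := by simp [slenPoly, slen]
/-- `QPoly` evaluates to `Q`. [folklore] -/
@[simp] theorem eval_QPoly (n : ℕ) : (P.QPoly Ad).eval n = P.Q Ad n := by simp [QPoly, Q, eval_comp]
/-- `RnPoly` evaluates to `Rn`. [folklore] -/
@[simp] theorem eval_RnPoly (n : ℕ) : (P.RnPoly Ad).eval n = P.Rn Ad n := by simp [RnPoly, Rn, Cn]
/-- `roundsPoly` evaluates to `rounds`. [folklore] -/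
@[simp] theorem eval_roundsPoly (n : ℕ) : (P.roundsPoly Ad).eval n = P.rounds Ad n := by simp [roundsPoly, rounds]

/-! ### The round loop: state `⟨x₁, ⟨1ᶜ, ⟨1^{cnt}, bits⟩⟩⟩`, `x₁ = ⟨1ⁿ, ⟨1ᵇ, ⟨1^κ, ⟨y, sd⟩⟩⟩⟩` -/

/-- The data of a round. [folklore] -/
def x1 (n b κ : ℕ) (y sd : List Bool) : List Bool :=
  boolPair (ones n) (boolPair (ones b) (boolPair (ones κ) (boolPair y sd)))

/-- The loop state. [folklore] -/
def st1 (n b κ : ℕ) (y sd : List Bool) (c cnt : ℕ) (bits : List Bool) : List Bool :=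
  boolPair (x1 n b κ y sd) (boolPair (ones c) (boolPair (ones cnt) bits))

/-! #### Projections and derived quantities (as functions of the state) -/

/-- `1ⁿ`. [folklore] -/
noncomputable def uN : List Bool → List Bool := fstF ∘ fstF
/-- `1ᵇ`. [folklore] -/
noncomputable def uB : List Bool → List Bool := nthF 1 ∘ fstF
/-- `1^κ`. [folklore] -/
noncomputable def uK : List Bool → List Bool := nthF 2 ∘ fstF
/-- `y`. [folklore] -/
noncomputable def yF : List Bool → List Bool := nthF 3 ∘ fstF
/-- `sd`. [folklore] -/
noncomputable def sdF : List Bool → List Bool := sndPow 3 ∘ fstF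
/-- `1ᶜ` (normalised to ones). [folklore] -/
noncomputable def cF : List Bool → List Bool := onesFn ∘ nthF 1
/-- `1^{cnt}`. [folklore] -/
noncomputable def cntF : List Bool → List Bool := nthF 2
/-- `bits`. [folklore] -/
noncomputable def bitsF : List Bool → List Bool := sndPow 2
/-- `1^{128 n}`. [folklore] -/
noncomputable def tmF : List Bool → List Bool := polyFn TmPoly ∘ uN
/-- `⟨1^i, 1^t⟩ = divMod c (128 n)`. [folklore] -/
noncomputable def dmF1 : List Bool → List Bool := divModFn ∘ fanoutFn tmF cF
/-- `1^i`. [folklore] -/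
noncomputable def iF1 : List Bool → List Bool := fstF ∘ dmF1
/-- `1^t`. [folklore] -/
noncomputable def tF1 : List Bool → List Bool := sndF ∘ dmF1
/-- `1^{D(n)}`. [folklore] -/
noncomputable def dnF : List Bool → List Bool := polyFn P.DnPoly ∘ uN
/-- The seeds `sd ↾ D(n)`. [folklore] -/
noncomputable def seedsF : List Bool → List Bool := takeFn ∘ fanoutFn P.dnF sdF
/-- The coins `sd ⇂ D(n)`. [folklore] -/
noncomputable def acF : List Bool → List Bool := dropFn ∘ fanoutFn P.dnF sdF
/-- `1^{L_h(n)}`. [folklore] -/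
noncomputable def lh1 : List Bool → List Bool := polyFn P.LhPoly ∘ uN
/-- `1^{L_g(n)}`. [folklore] -/
noncomputable def lg1 : List Bool → List Bool := polyFn LgPoly ∘ uN
/-- `1^{n+4}`. [folklore] -/
noncomputable def n4F : List Bool → List Bool := polyFn (X + 4) ∘ uN
/-- `1^{n+3}`. [folklore] -/
noncomputable def n3F : List Bool → List Bool := polyFn (X + 3) ∘ uN
/-- `σ_h = seeds ↾ L_h`. [folklore] -/
noncomputable def σhF : List Bool → List Bool := takeFn ∘ fanoutFn P.lh1 P.seedsF
/-- `seeds ⇂ L_h`. [folklore] -/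
noncomputable def t1F : List Bool → List Bool := dropFn ∘ fanoutFn P.lh1 P.seedsF
/-- `σ_g`. [folklore] -/
noncomputable def σgF : List Bool → List Bool := takeFn ∘ fanoutFn lg1 P.t1F
/-- `(seeds ⇂ L_h) ⇂ L_g`. [folklore] -/
noncomputable def t2F : List Bool → List Bool := dropFn ∘ fanoutFn lg1 P.t1F
/-- `u`. [folklore] -/
noncomputable def uuF : List Bool → List Bool := takeFn ∘ fanoutFn n4F P.t2F
/-- `((seeds ⇂ L_h) ⇂ L_g) ⇂ (n+4)`. [folklore] -/
noncomputable def t3F : List Bool → List Bool := dropFn ∘ fanoutFn n4F P.t2F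
/-- `pool`. [folklore] -/
noncomputable def poolF : List Bool → List Bool := takeFn ∘ fanoutFn (polyFn JpoolPoly ∘ uN) P.t3F
/-- `1^{n+4-b}`. [folklore] -/
noncomputable def a1F : List Bool → List Bool := dropFn ∘ fanoutFn uB n4F
/-- `pad_n(y)`. [folklore] -/
noncomputable def pad1F : List Bool → List Bool := pad10Fn ∘ fanoutFn (polyFn P.p ∘ uN) yF
/-- `h(ŷ)`. [folklore] -/
noncomputable def hH1F : List Bool → List Bool :=
  hashFn ∘ fanoutFn (fanoutFn (polyFn (P.p + 1) ∘ uN) a1F) (fanoutFn P.σhF P.pad1F)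
/-- `u ↾ b`. [folklore] -/
noncomputable def ubF : List Bool → List Bool := takeFn ∘ fanoutFn uB P.uuF
/-- `1^{J(n,b,i)}`. [folklore] -/
noncomputable def jnF : List Bool → List Bool :=
  concatFn ∘ fanoutFn (concatFn ∘ fanoutFn (polyFn (X ^ 2 * (X + 3)) ∘ uN) (umulFn ∘ fanoutFn n3F iF1)) uB
/-- `pool ↾ J(n,b,i)`. [folklore] -/
noncomputable def pjF : List Bool → List Bool := takeFn ∘ fanoutFn jnF P.poolF
/-- **The query `z_{b,i}`.** [Bogdanov–Trevisan 2006, §5.1.3 (reduction `R`)] [folklore] -/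
noncomputable def queryF : List Bool → List Bool :=
  concatFn ∘ fanoutFn (concatFn ∘ fanoutFn (concatFn ∘ fanoutFn (concatFn ∘ fanoutFn P.σhF P.σgF) P.hH1F) P.ubF) P.pjF
/-- `1^{N(n,b,i)}`. [folklore] -/
noncomputable def nlenF : List Bool → List Bool := concatFn ∘ fanoutFn (polyFn P.WPoly ∘ uN) jnF
/-- `1^{m(n,b,i)}`. [folklore] -/
noncomputable def mOfF : List Bool → List Bool :=
  concatFn ∘ fanoutFn (polyFn m0Poly ∘ uN)
    (umulFn ∘ fanoutFn (fun _ => ones 4) (dropFn ∘ fanoutFn P.nlenF (polyFn P.NmaxPoly ∘ uN)))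
/-- The scheme input `⟨z, ⟨1^N, 1^m⟩⟩`. [folklore] -/
noncomputable def schInF : List Bool → List Bool := fanoutFn P.queryF (fanoutFn P.nlenF P.mOfF)
/-- `1^{κ · 128 n}`. [folklore] -/
noncomputable def ktF : List Bool → List Bool := umulFn ∘ fanoutFn uK tmF
/-- The `i`-th coin segment `(ac ⇂ i κ 128n) ↾ κ 128n`. [folklore] -/
noncomputable def segIF : List Bool → List Bool := takeFn ∘ fanoutFn ktF (dropFn ∘ fanoutFn (umulFn ∘ fanoutFn iF1 ktF) P.acF)
/-- The coin block `ρ = (seg_i ⇂ t κ) ↾ κ`. [folklore] -/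
noncomputable def rhoF : List Bool → List Bool := takeFn ∘ fanoutFn uK (dropFn ∘ fanoutFn (umulFn ∘ fanoutFn tF1 uK) P.segIF)
/-- **The run's answer bit** `[A(z_{b,i}; 1^N, 1^m; ρ)]`. [folklore] -/
noncomputable def bitF : List Bool → List Bool := rsFn Ad.A ∘ fanoutFn P.schInF P.rhoF
/-- The guard `[c < 128 n · n]`. [folklore] -/
noncomputable def guardF : List Bool → List Bool := lenLeFn X ∘ fanoutFn (umulFn ∘ fanoutFn uN tmF) (List.cons true ∘ cF)
/-- The end-of-group test `[t + 1 = 128 n]`. [folklore] -/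
noncomputable def endF : List Bool → List Bool := eqPairFn ∘ fanoutFn (List.cons true ∘ tF1) tmF
/-- The count including the current run. [folklore] -/
noncomputable def cnt2F : List Bool → List Bool := iteFn (P.bitF Ad) (List.cons true ∘ cntF) cntF
/-- The majority bit of the group `[128 n < 2 · cnt]`. [folklore] -/
noncomputable def majF : List Bool → List Bool :=
  lenLeFn X ∘ fanoutFn (concatFn ∘ fanoutFn (P.cnt2F Ad) (P.cnt2F Ad)) (List.cons true ∘ tmF)
/-- The new count. [folklore] -/
noncomputable def cntNew : List Bool → List Bool := iteFn guardF (iteFn endF (fun _ => []) (P.cnt2F Ad)) cntF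
/-- The new bits. [folklore] -/
noncomputable def bitsNew : List Bool → List Bool :=
  iteFn guardF (iteFn endF (concatFn ∘ fanoutFn bitsF (P.majF Ad)) bitsF) bitsF
/-- **One run = one round of the loop.** [Bogdanov–Trevisan 2006, proof of Claim 28; Arora–Barak 2009,
§7.4.1] [folklore] -/
noncomputable def rbody : List Bool → List Bool :=
  fanoutFn fstF (fanoutFn (List.cons true ∘ cF) (fanoutFn (P.cntNew Ad) (P.bitsNew Ad)))

/-- The initial state of the round. [folklore] -/
noncomputable def init1F : List Bool → List Bool := fanoutFn (fun w => w) (fun _ => boolPair [] (boolPair [] []))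

/-- **The candidate of the round**: `128 n²` runs of the loop (clocked by `128 X²` at `|x₁| ≥ n`)
from the initial state, then the bits. [folklore] -/
noncomputable def candFn : List Bool → List Bool :=
  bitsF ∘ (fun S => (P.rbody Ad)^[(128 * X ^ 2 : Polynomial ℕ).eval (boolUnpair S).1.length] S) ∘ init1F

/-! #### The specification of the loop -/

/-- The `t`-th run of query `i`. [folklore] -/
def runBit (n b κ : ℕ) (y sd : List Bool) (i t : ℕ) : Bool :=
  Ad.A.run (P.squery n b i y (sd.take (P.Dn n)), P.Nlen n b i, P.mOf n b i) (seg κ t (seg (κ * Tm n) i (sd.drop (P.Dn n))))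

/-- The bits after `c` runs: the finished majority answers. [folklore] -/
def bitsAt (n b κ : ℕ) (y sd : List Bool) (c : ℕ) : List Bool :=
  (List.range (c / Tm n)).map fun i => maj ((List.range (Tm n)).map (P.runBit Ad n b κ y sd i))

/-- The count after `c` runs: the number of positive runs in the current group. [folklore] -/
def cntAt (n b κ : ℕ) (y sd : List Bool) (c : ℕ) : ℕ :=
  (((List.range (c % Tm n)).map (P.runBit Ad n b κ y sd (c / Tm n))).count true)

/-- The model of one run: new count and new bits from `(c, cnt, bits)`. [folklore] -/
def stepModel (n b κ : ℕ) (y sd : List Bool) (c cnt : ℕ) (bits : List Bool) : ℕ × List Bool :=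
  if c < n * Tm n then
    if c % Tm n + 1 = Tm n then
      (0, bits ++ [decide (Tm n < 2 * (cnt + if P.runBit Ad n b κ y sd (c / Tm n) (c % Tm n) then 1 else 0))])
    else (cnt + (if P.runBit Ad n b κ y sd (c / Tm n) (c % Tm n) then 1 else 0), bits)
  else (cnt, bits)

/-! #### Values on well-formed states -/

section Values

variable {P Ad}
variable (n b κ : ℕ) (y sd : List Bool) (c cnt : ℕ) (bits : List Bool)

/-- `unaryEncodeNat m = 1ᵐ`. [folklore] -/
theorem unaryEncodeNat_eq_ones (m : ℕ) : unaryEncodeNat m = ones m := Complexity.unaryEncodeNat_eq_replicate m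

/-- Reading `1ⁿ`. [folklore] -/
@[simp] theorem uN_st1 : uN (st1 n b κ y sd c cnt bits) = ones n := by simp [uN, st1, x1]
/-- Reading `1ᵇ`. [folklore] -/
@[simp] theorem uB_st1 : uB (st1 n b κ y sd c cnt bits) = ones b := by simp [uB, st1, x1]
/-- Reading `1^κ`. [folklore] -/
@[simp] theorem uK_st1 : uK (st1 n b κ y sd c cnt bits) = ones κ := by simp [uK, st1, x1]
/-- Reading `y`. [folklore] -/
@[simp] theorem yF_st1 : yF (st1 n b κ y sd c cnt bits) = y := by simp [yF, st1, x1]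
/-- Reading `sd`. [folklore] -/
@[simp] theorem sdF_st1 : sdF (st1 n b κ y sd c cnt bits) = sd := by simp [sdF, st1, x1, sndPow]
/-- Reading `1ᶜ`. [folklore] -/
@[simp] theorem cF_st1 : cF (st1 n b κ y sd c cnt bits) = ones c := by simp [cF, st1, onesFn, unaryEncodeNat_eq_ones]
/-- Reading `1^{cnt}`. [folklore] -/
@[simp] theorem cntF_st1 : cntF (st1 n b κ y sd c cnt bits) = ones cnt := by simp [cntF, st1]
/-- Reading `bits`. [folklore] -/
@[simp] theorem bitsF_st1 : bitsF (st1 n b κ y sd c cnt bits) = bits := by simp [bitsF, st1, sndPow]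
/-- `1^{128 n}`. [folklore] -/
@[simp] theorem tmF_st1 : tmF (st1 n b κ y sd c cnt bits) = ones (Tm n) := by simp [tmF, polyFn_apply]
/-- `⟨1^i, 1^t⟩`. [folklore] -/
@[simp] theorem dmF1_st1 : dmF1 (st1 n b κ y sd c cnt bits) = boolPair (ones (c / Tm n)) (ones (c % Tm n)) := by
  simp [dmF1]
/-- `1^i`. [folklore] -/
@[simp] theorem iF1_st1 : iF1 (st1 n b κ y sd c cnt bits) = ones (c / Tm n) := by simp [iF1]
/-- `1^t`. [folklore] -/
@[simp] theorem tF1_st1 : tF1 (st1 n b κ y sd c cnt bits) = ones (c % Tm n) := by simp [tF1]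
/-- `1^{D(n)}`. [folklore] -/
@[simp] theorem dnF_st1 : P.dnF (st1 n b κ y sd c cnt bits) = ones (P.Dn n) := by simp [dnF, polyFn_apply]
/-- The seeds. [folklore] -/
@[simp] theorem seedsF_st1 : P.seedsF (st1 n b κ y sd c cnt bits) = sd.take (P.Dn n) := by simp [seedsF]
/-- The coins. [folklore] -/
@[simp] theorem acF_st1 : P.acF (st1 n b κ y sd c cnt bits) = sd.drop (P.Dn n) := by simp [acF]
/-- `1^{L_h}`. [folklore] -/
@[simp] theorem lh1_st1 : P.lh1 (st1 n b κ y sd c cnt bits) = ones (P.Lh n) := by simp [lh1, polyFn_apply]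
/-- `1^{L_g}`. [folklore] -/
@[simp] theorem lg1_st1 : lg1 (st1 n b κ y sd c cnt bits) = ones (Lg n) := by simp [lg1, polyFn_apply]
/-- `1^{n+4}`. [folklore] -/
@[simp] theorem n4F_st1 : n4F (st1 n b κ y sd c cnt bits) = ones (n + 4) := by simp [n4F, polyFn_apply]
/-- `1^{n+3}`. [folklore] -/
@[simp] theorem n3F_st1 : n3F (st1 n b κ y sd c cnt bits) = ones (n + 3) := by simp [n3F, polyFn_apply]
/-- `σ_h`. [folklore] -/
@[simp] theorem σhF_st1 : P.σhF (st1 n b κ y sd c cnt bits) = (sd.take (P.Dn n)).take (P.Lh n) := by simp [σhF]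
/-- `seeds ⇂ L_h`. [folklore] -/
@[simp] theorem t1F_st1 : P.t1F (st1 n b κ y sd c cnt bits) = (sd.take (P.Dn n)).drop (P.Lh n) := by simp [t1F]
/-- `σ_g`. [folklore] -/
@[simp] theorem σgF_st1 : P.σgF (st1 n b κ y sd c cnt bits) = ((sd.take (P.Dn n)).drop (P.Lh n)).take (Lg n) := by simp [σgF]
/-- `(seeds ⇂ L_h) ⇂ L_g`. [folklore] -/
@[simp] theorem t2F_st1 : P.t2F (st1 n b κ y sd c cnt bits) = ((sd.take (P.Dn n)).drop (P.Lh n)).drop (Lg n) := by simp [t2F]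
/-- `u`. [folklore] -/
@[simp] theorem uuF_st1 : P.uuF (st1 n b κ y sd c cnt bits) = (((sd.take (P.Dn n)).drop (P.Lh n)).drop (Lg n)).take (n + 4) := by
  simp [uuF]
/-- `((seeds ⇂ L_h) ⇂ L_g) ⇂ (n+4)`. [folklore] -/
@[simp] theorem t3F_st1 : P.t3F (st1 n b κ y sd c cnt bits) = (((sd.take (P.Dn n)).drop (P.Lh n)).drop (Lg n)).drop (n + 4) := by
  simp [t3F]
/-- `pool`. [folklore] -/
@[simp] theorem poolF_st1 : P.poolF (st1 n b κ y sd c cnt bits) =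
    ((((sd.take (P.Dn n)).drop (P.Lh n)).drop (Lg n)).drop (n + 4)).take (Jpool n) := by
  simp [poolF, polyFn_apply]
/-- `1^{n+4-b}`. [folklore] -/
@[simp] theorem a1F_st1 : a1F (st1 n b κ y sd c cnt bits) = ones (n + 4 - b) := by simp [a1F, ones, List.drop_replicate]
/-- `pad_n(y)`. [folklore] -/
@[simp] theorem pad1F_st1 : P.pad1F (st1 n b κ y sd c cnt bits) = P.pad n y := by simp [pad1F, polyFn_apply, pad]
/-- `h(ŷ)`. [folklore] -/
@[simp] theorem hH1F_st1 : P.hH1F (st1 n b κ y sd c cnt bits) = P.hH n b ((sd.take (P.Dn n)).take (P.Lh n)) (P.pad n y) := by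
  simp only [hH1F, Function.comp_apply, fanoutFn_apply, polyFn_apply, uN_st1, List.length_replicate, eval_add, eval_one,
    a1F_st1, σhF_st1, pad1F_st1, hH, Pd]
  exact hashFn_boolPair _ _ _ _
/-- `u ↾ b`. [folklore] -/
@[simp] theorem ubF_st1 : P.ubF (st1 n b κ y sd c cnt bits) = ((((sd.take (P.Dn n)).drop (P.Lh n)).drop (Lg n)).take (n + 4)).take b := by
  simp [ubF]
/-- `1^{J(n,b,i)}`. [folklore] -/
@[simp] theorem jnF_st1 : jnF (st1 n b κ y sd c cnt bits) = ones (Jn n b (c / Tm n)) := by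
  simp [jnF, polyFn_apply, Jn, ones]
/-- `pool ↾ J`. [folklore] -/
@[simp] theorem pjF_st1 : P.pjF (st1 n b κ y sd c cnt bits) =
    (((((sd.take (P.Dn n)).drop (P.Lh n)).drop (Lg n)).drop (n + 4)).take (Jpool n)).take (Jn n b (c / Tm n)) := by
  simp [pjF]
/-- **The query.** [folklore] -/
@[simp] theorem queryF_st1 : P.queryF (st1 n b κ y sd c cnt bits) = P.squery n b (c / Tm n) y (sd.take (P.Dn n)) := by
  simp [queryF, squery, query]
/-- `1^{N}`. [folklore] -/
@[simp] theorem nlenF_st1 : P.nlenF (st1 n b κ y sd c cnt bits) = ones (P.Nlen n b (c / Tm n)) := by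
  simp [nlenF, polyFn_apply, Nlen, ones]
/-- `1^{m}`. [folklore] -/
@[simp] theorem mOfF_st1 : P.mOfF (st1 n b κ y sd c cnt bits) = ones (P.mOf n b (c / Tm n)) := by
  simp [mOfF, polyFn_apply, mOf, ones, List.drop_replicate, umulFn_apply]
/-- The scheme input. [folklore] -/
@[simp] theorem schInF_st1 : P.schInF (st1 n b κ y sd c cnt bits) =
    schemeEnc (P.squery n b (c / Tm n) y (sd.take (P.Dn n)), P.Nlen n b (c / Tm n), P.mOf n b (c / Tm n)) := by
  simp [schInF, schemeEnc, unaryEncodeNat_eq_ones]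
/-- `1^{κ 128n}`. [folklore] -/
@[simp] theorem ktF_st1 : ktF (st1 n b κ y sd c cnt bits) = ones (κ * Tm n) := by simp [ktF]
/-- The `i`-th coin segment. [folklore] -/
@[simp] theorem segIF_st1 : P.segIF (st1 n b κ y sd c cnt bits) = seg (κ * Tm n) (c / Tm n) (sd.drop (P.Dn n)) := by
  simp [segIF, seg]
/-- The coin block. [folklore] -/
@[simp] theorem rhoF_st1 : P.rhoF (st1 n b κ y sd c cnt bits) = seg κ (c % Tm n) (seg (κ * Tm n) (c / Tm n) (sd.drop (P.Dn n))) := by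
  simp [rhoF, seg]
/-- **The run's answer bit.** [folklore] -/
@[simp] theorem bitF_st1 : P.bitF Ad (st1 n b κ y sd c cnt bits) = [P.runBit Ad n b κ y sd (c / Tm n) (c % Tm n)] := by
  simp [bitF, runBit]
/-- The guard. [folklore] -/
@[simp] theorem guardF_st1 : guardF (st1 n b κ y sd c cnt bits) = [decide (c < n * Tm n)] := by
  simp [guardF, lenLeFn_boolPair]
/-- The end-of-group test. [folklore] -/
@[simp] theorem endF_st1 : endF (st1 n b κ y sd c cnt bits) = [decide (c % Tm n + 1 = Tm n)] := by
  simp [endF, eqPairFn_boolPair, Plumb.true_cons_ones_eq_iff]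
/-- The count including the current run. [folklore] -/
@[simp] theorem cnt2F_st1 : P.cnt2F Ad (st1 n b κ y sd c cnt bits) =
    ones (cnt + if P.runBit Ad n b κ y sd (c / Tm n) (c % Tm n) then 1 else 0) := by
  rw [cnt2F, iteFn_apply (bitF_st1 n b κ y sd c cnt bits)]
  split_ifs <;> simp [ones, List.replicate_succ]
/-- The majority bit. [folklore] -/
@[simp] theorem majF_st1 : P.majF Ad (st1 n b κ y sd c cnt bits) =
    [decide (Tm n < 2 * (cnt + if P.runBit Ad n b κ y sd (c / Tm n) (c % Tm n) then 1 else 0))] := by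
  simp only [majF, Function.comp_apply, fanoutFn_apply, cnt2F_st1, tmF_st1, concatFn_boolPair, lenLeFn_boolPair,
    List.length_cons, List.length_append, List.length_replicate, eval_X, ← two_mul, Nat.add_one_le_iff]

/-- **One run on a well-formed state.** [folklore] -/
theorem rbody_st1 : P.rbody Ad (st1 n b κ y sd c cnt bits) =
    st1 n b κ y sd (c + 1) (P.stepModel Ad n b κ y sd c cnt bits).1 (P.stepModel Ad n b κ y sd c cnt bits).2 := by
  have hc : cntNew P Ad (st1 n b κ y sd c cnt bits) = ones (P.stepModel Ad n b κ y sd c cnt bits).1 := by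
    rw [cntNew, iteFn_apply (guardF_st1 n b κ y sd c cnt bits)]
    unfold stepModel
    split_ifs with h1 h2 <;> simp_all [iteFn_apply (endF_st1 n b κ y sd c cnt bits)]
  have hb : bitsNew P Ad (st1 n b κ y sd c cnt bits) = (P.stepModel Ad n b κ y sd c cnt bits).2 := by
    rw [bitsNew, iteFn_apply (guardF_st1 n b κ y sd c cnt bits)]
    unfold stepModel
    split_ifs with h1 h2 <;> simp_all [iteFn_apply (endF_st1 n b κ y sd c cnt bits)]
  simp only [rbody, fanoutFn_apply, Function.comp_apply, hc, hb, cF_st1]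
  simp [st1, ones, List.replicate_succ]

end Values

/-! #### Semantics of the loop -/

section Semantics

variable {P Ad}
variable (n b κ : ℕ) (y sd : List Bool)

/-- The model of the loop: `(cnt, bits)` after `k` runs. [folklore] -/
def loopAt : ℕ → ℕ × List Bool
  | 0 => (0, [])
  | k + 1 => P.stepModel Ad n b κ y sd k (loopAt k).1 (loopAt k).2

/-- **The runs iterate the model.** [folklore] -/
theorem iterate_rbody : ∀ k : ℕ,
    (P.rbody Ad)^[k] (st1 n b κ y sd 0 0 []) = st1 n b κ y sd k (P.loopAt (Ad := Ad) n b κ y sd k).1 (P.loopAt (Ad := Ad) n b κ y sd k).2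
  | 0 => rfl
  | k + 1 => by rw [Function.iterate_succ_apply', iterate_rbody k, rbody_st1]; rfl

/-- Counting one more run. [folklore] -/
theorem cntAt_succ_of_lt {c : ℕ} (ht : c % Tm n + 1 < Tm n) :
    P.cntAt Ad n b κ y sd (c + 1) = P.cntAt Ad n b κ y sd c + (if P.runBit Ad n b κ y sd (c / Tm n) (c % Tm n) then 1 else 0) := by
  have hdm := Plumb.div_mod_succ c (Tm n)
  rw [if_neg (by omega)] at hdm
  simp only [Prod.mk.injEq] at hdm
  unfold cntAt
  rw [hdm.1, hdm.2, List.range_succ, List.map_append, List.count_append, List.map_singleton]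
  cases P.runBit Ad n b κ y sd (c / Tm n) (c % Tm n) <;> simp

/-- Finishing a group: the appended bit is the majority of the group's runs. [folklore] -/
theorem bitsAt_succ_of_eq {c : ℕ} (ht : c % Tm n + 1 = Tm n) :
    P.bitsAt Ad n b κ y sd (c + 1) =
      P.bitsAt Ad n b κ y sd c ++ [decide (Tm n < 2 * (P.cntAt Ad n b κ y sd c +
        if P.runBit Ad n b κ y sd (c / Tm n) (c % Tm n) then 1 else 0))] ∧ P.cntAt Ad n b κ y sd (c + 1) = 0 := by
  have hdm := Plumb.div_mod_succ c (Tm n)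
  rw [if_pos ht] at hdm
  simp only [Prod.mk.injEq] at hdm
  unfold bitsAt cntAt
  rw [hdm.1, hdm.2, List.range_succ, List.map_append, List.map_singleton]
  refine ⟨?_, by simp⟩
  congr 2
  unfold maj
  have hr : List.range (Tm n) = List.range (c % Tm n) ++ [c % Tm n] := by rw [← List.range_succ]; exact congrArg List.range ht.symm
  rw [List.length_map, List.length_range, hr, List.map_append, List.count_append, List.map_singleton]
  cases P.runBit Ad n b κ y sd (c / Tm n) (c % Tm n) <;> simp

/-- **The model is the specification**: for `k ≤ 128 n · n` runs, the state holds the finished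
majorities and the current count; afterwards it idles. [folklore] -/
theorem loopAt_eq : ∀ k : ℕ, P.loopAt (Ad := Ad) n b κ y sd k =
    (P.cntAt Ad n b κ y sd (min k (n * Tm n)), P.bitsAt Ad n b κ y sd (min k (n * Tm n)))
  | 0 => by simp [loopAt, cntAt, bitsAt]
  | k + 1 => by
    rw [loopAt, loopAt_eq k]
    unfold stepModel
    by_cases hk : k < n * Tm n
    · rw [Nat.min_eq_left hk.le, Nat.min_eq_left hk, if_pos hk]
      by_cases ht : k % Tm n + 1 = Tm n
      · rw [if_pos ht]
        obtain ⟨h1, h2⟩ := bitsAt_succ_of_eq (P := P) (Ad := Ad) n b κ y sd ht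
        rw [h1, h2]
      · rw [if_neg ht]
        have hTm : 0 < Tm n := by
          rcases Nat.eq_zero_or_pos (Tm n) with h0 | h0
          · rw [h0, Nat.mul_zero] at hk; omega
          · exact h0
        have hlt : k % Tm n + 1 < Tm n := by have := Nat.mod_lt k hTm; omega
        rw [cntAt_succ_of_lt (P := P) (Ad := Ad) n b κ y sd hlt]
        unfold bitsAt
        have hdm := Plumb.div_mod_succ k (Tm n)
        rw [if_neg ht] at hdm
        simp only [Prod.mk.injEq] at hdm
        rw [hdm.1]
    · rw [if_neg hk, Nat.min_eq_right (not_lt.1 hk), Nat.min_eq_right (by omega)]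

/-- The finished majorities after all runs are the answers of the round. [folklore] -/
theorem bitsAt_all : P.bitsAt Ad n b κ y sd (n * Tm n) = P.cand Ad n b κ y sd := by
  unfold bitsAt cand answer runBit
  rcases Nat.eq_zero_or_pos n with rfl | hn
  · simp
  · rw [Nat.mul_div_cancel _ (by unfold Tm; omega)]

/-- The initial state. [folklore] -/
theorem init1F_x1 : init1F (x1 n b κ y sd) = st1 n b κ y sd 0 0 [] := by simp [init1F, st1, ones]

/-- **The round function computes the candidate**: `candFn ⟨1ⁿ, ⟨1ᵇ, ⟨1^κ, ⟨y, sd⟩⟩⟩⟩ = cand n b κ y sd`.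
[Bogdanov–Trevisan 2006, proof of Claim 28; Arora–Barak 2009, §7.4.1] [folklore] -/
theorem candFn_x1 : P.candFn Ad (x1 n b κ y sd) = P.cand Ad n b κ y sd := by
  have hK : n * Tm n ≤ (128 * X ^ 2 : Polynomial ℕ).eval (boolUnpair (st1 n b κ y sd 0 0 [])).1.length := by
    rw [st1, boolUnpair_boolPair]
    have h : n ≤ (x1 n b κ y sd).length := by simp [x1]; omega
    unfold Tm
    simp only [eval_mul, eval_ofNat, eval_pow, eval_X]
    nlinarith
  simp only [candFn, Function.comp_apply, init1F_x1]
  rw [iterate_rbody, bitsF_st1, loopAt_eq, Nat.min_eq_right hK, bitsAt_all]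

end Semantics

/-! #### Growth on every word -/

section Growth

variable {P Ad}

/-- `lenLeFn p` is one-bit. [folklore] -/
theorem oneBit_lenLeFn (p : Polynomial ℕ) : OneBit (lenLeFn p) := fun w => by
  rcases lenLeFn_eq_or p w with h | h <;> exact ⟨_, h⟩

/-- `eqPairFn` is one-bit. [folklore] -/
theorem oneBit_eqPairFn : OneBit eqPairFn := fun w => by
  rcases eqPairFn_eq_or w with h | h <;> exact ⟨_, h⟩

/-- The answer bit is one-bit. [folklore] -/
theorem oneBit_bitF : OneBit (P.bitF Ad) := (oneBit_rsFn Ad.A).comp _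
/-- The guard is one-bit. [folklore] -/
theorem oneBit_guardF : OneBit guardF := (oneBit_lenLeFn X).comp _
/-- The end-of-group test is one-bit. [folklore] -/
theorem oneBit_endF : OneBit endF := oneBit_eqPairFn.comp _
/-- The majority bit is one-bit. [folklore] -/
theorem oneBit_majF : OneBit (P.majF Ad) := (oneBit_lenLeFn X).comp _

/-- The count grows by at most one symbol. [folklore] -/
theorem length_cntNew_le (S : List Bool) : (P.cntNew Ad S).length ≤ (cntF S).length + 1 := by
  have h2 : (P.cnt2F Ad S).length ≤ (cntF S).length + 1 := by
    rw [cnt2F, iteFn_of_oneBit (oneBit_bitF (P := P) (Ad := Ad))]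
    split_ifs <;> simp
  rw [cntNew, iteFn_of_oneBit oneBit_guardF]
  split_ifs
  · rw [iteFn_of_oneBit oneBit_endF]
    split_ifs
    · simp
    · exact h2
  · omega

/-- The bits grow by at most one symbol. [folklore] -/
theorem length_bitsNew_le (S : List Bool) : (P.bitsNew Ad S).length ≤ (bitsF S).length + 1 := by
  rw [bitsNew, iteFn_of_oneBit oneBit_guardF]
  split_ifs
  · rw [iteFn_of_oneBit oneBit_endF]
    split_ifs
    · simp only [Function.comp_apply, fanoutFn_apply, concatFn_boolPair, List.length_append]
      rw [(oneBit_majF (P := P) (Ad := Ad)).length_eq]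
    · omega
  · omega

/-- **Additive growth of a run on every word**: `|rbody S| ≤ |S| + 11`. [folklore] -/
theorem length_rbody_le (S : List Bool) : (P.rbody Ad S).length ≤ S.length + 11 := by
  have h0 := length_fstF_sndF_le S
  have h1 := length_fstF_sndF_le (sndF S)
  have h2 := length_fstF_sndF_le (sndF (sndF S))
  have hc := length_cntNew_le (P := P) (Ad := Ad) S
  have hb := length_bitsNew_le (P := P) (Ad := Ad) S
  have e1 : nthF 1 S = fstF (sndF S) := rfl
  have e2 : cntF S = fstF (sndF (sndF S)) := rfl
  have e3 : bitsF S = sndF (sndF (sndF S)) := rfl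
  rw [e2] at hc
  rw [e3] at hb
  simp only [rbody, fanoutFn_apply, Function.comp_apply, length_boolPair, List.length_cons, cF, length_onesFn, e1]
  omega

end Growth

/-! #### `FP` membership -/

section FP

variable {P Ad}

/-- `uN ∈ FP`. [folklore] -/
theorem uN_mem_FP : uN ∈ FP := comp_mem_FP fstF_mem_FP fstF_mem_FP
/-- `uB ∈ FP`. [folklore] -/
theorem uB_mem_FP : uB ∈ FP := comp_mem_FP (nthF_mem_FP 1) fstF_mem_FP
/-- `uK ∈ FP`. [folklore] -/
theorem uK_mem_FP : uK ∈ FP := comp_mem_FP (nthF_mem_FP 2) fstF_mem_FP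
/-- `yF ∈ FP`. [folklore] -/
theorem yF_mem_FP : yF ∈ FP := comp_mem_FP (nthF_mem_FP 3) fstF_mem_FP
/-- `sdF ∈ FP`. [folklore] -/
theorem sdF_mem_FP : sdF ∈ FP := comp_mem_FP (sndPow_mem_FP 3) fstF_mem_FP
/-- `cF ∈ FP`. [folklore] -/
theorem cF_mem_FP : cF ∈ FP := comp_mem_FP onesFn_mem_FP (nthF_mem_FP 1)
/-- `tmF ∈ FP`. [folklore] -/
theorem tmF_mem_FP : tmF ∈ FP := comp_mem_FP (polyFn_mem_FP _) uN_mem_FP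
/-- `dmF1 ∈ FP`. [folklore] -/
theorem dmF1_mem_FP : dmF1 ∈ FP := comp_mem_FP divModFn_mem_FP (fanoutFn_mem_FP tmF_mem_FP cF_mem_FP)
/-- `iF1 ∈ FP`. [folklore] -/
theorem iF1_mem_FP : iF1 ∈ FP := comp_mem_FP fstF_mem_FP dmF1_mem_FP
/-- `tF1 ∈ FP`. [folklore] -/
theorem tF1_mem_FP : tF1 ∈ FP := comp_mem_FP sndF_mem_FP dmF1_mem_FP
/-- `dnF ∈ FP`. [folklore] -/
theorem dnF_mem_FP : P.dnF ∈ FP := comp_mem_FP (polyFn_mem_FP _) uN_mem_FP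
/-- `seedsF ∈ FP`. [folklore] -/
theorem seedsF_mem_FP : P.seedsF ∈ FP := comp_mem_FP takeFn_mem_FP (fanoutFn_mem_FP dnF_mem_FP sdF_mem_FP)
/-- `acF ∈ FP`. [folklore] -/
theorem acF_mem_FP : P.acF ∈ FP := comp_mem_FP dropFn_mem_FP (fanoutFn_mem_FP dnF_mem_FP sdF_mem_FP)
/-- `lh1 ∈ FP`. [folklore] -/
theorem lh1_mem_FP : P.lh1 ∈ FP := comp_mem_FP (polyFn_mem_FP _) uN_mem_FP
/-- `lg1 ∈ FP`. [folklore] -/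
theorem lg1_mem_FP : lg1 ∈ FP := comp_mem_FP (polyFn_mem_FP _) uN_mem_FP
/-- `n4F ∈ FP`. [folklore] -/
theorem n4F_mem_FP : n4F ∈ FP := comp_mem_FP (polyFn_mem_FP _) uN_mem_FP
/-- `n3F ∈ FP`. [folklore] -/
theorem n3F_mem_FP : n3F ∈ FP := comp_mem_FP (polyFn_mem_FP _) uN_mem_FP
/-- `σhF ∈ FP`. [folklore] -/
theorem σhF_mem_FP : P.σhF ∈ FP := comp_mem_FP takeFn_mem_FP (fanoutFn_mem_FP lh1_mem_FP seedsF_mem_FP)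
/-- `t1F ∈ FP`. [folklore] -/
theorem t1F_mem_FP : P.t1F ∈ FP := comp_mem_FP dropFn_mem_FP (fanoutFn_mem_FP lh1_mem_FP seedsF_mem_FP)
/-- `σgF ∈ FP`. [folklore] -/
theorem σgF_mem_FP : P.σgF ∈ FP := comp_mem_FP takeFn_mem_FP (fanoutFn_mem_FP lg1_mem_FP t1F_mem_FP)
/-- `t2F ∈ FP`. [folklore] -/
theorem t2F_mem_FP : P.t2F ∈ FP := comp_mem_FP dropFn_mem_FP (fanoutFn_mem_FP lg1_mem_FP t1F_mem_FP)
/-- `uuF ∈ FP`. [folklore] -/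
theorem uuF_mem_FP : P.uuF ∈ FP := comp_mem_FP takeFn_mem_FP (fanoutFn_mem_FP n4F_mem_FP t2F_mem_FP)
/-- `t3F ∈ FP`. [folklore] -/
theorem t3F_mem_FP : P.t3F ∈ FP := comp_mem_FP dropFn_mem_FP (fanoutFn_mem_FP n4F_mem_FP t2F_mem_FP)
/-- `poolF ∈ FP`. [folklore] -/
theorem poolF_mem_FP : P.poolF ∈ FP :=
  comp_mem_FP takeFn_mem_FP (fanoutFn_mem_FP (comp_mem_FP (polyFn_mem_FP _) uN_mem_FP) t3F_mem_FP)
/-- `a1F ∈ FP`. [folklore] -/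
theorem a1F_mem_FP : a1F ∈ FP := comp_mem_FP dropFn_mem_FP (fanoutFn_mem_FP uB_mem_FP n4F_mem_FP)
/-- `pad1F ∈ FP`. [folklore] -/
theorem pad1F_mem_FP : P.pad1F ∈ FP := comp_mem_FP pad10Fn_mem_FP (fanoutFn_mem_FP (comp_mem_FP (polyFn_mem_FP _) uN_mem_FP) yF_mem_FP)
/-- `hH1F ∈ FP`. [folklore] -/
theorem hH1F_mem_FP : P.hH1F ∈ FP :=
  comp_mem_FP hashFn_mem_FP (fanoutFn_mem_FP (fanoutFn_mem_FP (comp_mem_FP (polyFn_mem_FP _) uN_mem_FP) a1F_mem_FP)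
    (fanoutFn_mem_FP σhF_mem_FP pad1F_mem_FP))
/-- `ubF ∈ FP`. [folklore] -/
theorem ubF_mem_FP : P.ubF ∈ FP := comp_mem_FP takeFn_mem_FP (fanoutFn_mem_FP uB_mem_FP uuF_mem_FP)
/-- `jnF ∈ FP`. [folklore] -/
theorem jnF_mem_FP : jnF ∈ FP :=
  comp_mem_FP concatFn_mem_FP (fanoutFn_mem_FP (comp_mem_FP concatFn_mem_FP (fanoutFn_mem_FP
    (comp_mem_FP (polyFn_mem_FP _) uN_mem_FP) (comp_mem_FP umulFn_mem_FP (fanoutFn_mem_FP n3F_mem_FP iF1_mem_FP)))) uB_mem_FP)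
/-- `pjF ∈ FP`. [folklore] -/
theorem pjF_mem_FP : P.pjF ∈ FP := comp_mem_FP takeFn_mem_FP (fanoutFn_mem_FP jnF_mem_FP poolF_mem_FP)
/-- `queryF ∈ FP`. [folklore] -/
theorem queryF_mem_FP : P.queryF ∈ FP :=
  comp_mem_FP concatFn_mem_FP (fanoutFn_mem_FP (comp_mem_FP concatFn_mem_FP (fanoutFn_mem_FP
    (comp_mem_FP concatFn_mem_FP (fanoutFn_mem_FP (comp_mem_FP concatFn_mem_FP (fanoutFn_mem_FP σhF_mem_FP σgF_mem_FP))
      hH1F_mem_FP)) ubF_mem_FP)) pjF_mem_FP)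
/-- `nlenF ∈ FP`. [folklore] -/
theorem nlenF_mem_FP : P.nlenF ∈ FP :=
  comp_mem_FP concatFn_mem_FP (fanoutFn_mem_FP (comp_mem_FP (polyFn_mem_FP _) uN_mem_FP) jnF_mem_FP)
/-- `mOfF ∈ FP`. [folklore] -/
theorem mOfF_mem_FP : P.mOfF ∈ FP :=
  comp_mem_FP concatFn_mem_FP (fanoutFn_mem_FP (comp_mem_FP (polyFn_mem_FP _) uN_mem_FP)
    (comp_mem_FP umulFn_mem_FP (fanoutFn_mem_FP (const_mem_FP _) (comp_mem_FP dropFn_mem_FP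
      (fanoutFn_mem_FP nlenF_mem_FP (comp_mem_FP (polyFn_mem_FP _) uN_mem_FP))))))
/-- `schInF ∈ FP`. [folklore] -/
theorem schInF_mem_FP : P.schInF ∈ FP := fanoutFn_mem_FP queryF_mem_FP (fanoutFn_mem_FP nlenF_mem_FP mOfF_mem_FP)
/-- `ktF ∈ FP`. [folklore] -/
theorem ktF_mem_FP : ktF ∈ FP := comp_mem_FP umulFn_mem_FP (fanoutFn_mem_FP uK_mem_FP tmF_mem_FP)
/-- `segIF ∈ FP`. [folklore] -/
theorem segIF_mem_FP : P.segIF ∈ FP :=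
  comp_mem_FP takeFn_mem_FP (fanoutFn_mem_FP ktF_mem_FP (comp_mem_FP dropFn_mem_FP
    (fanoutFn_mem_FP (comp_mem_FP umulFn_mem_FP (fanoutFn_mem_FP iF1_mem_FP ktF_mem_FP)) acF_mem_FP)))
/-- `rhoF ∈ FP`. [folklore] -/
theorem rhoF_mem_FP : P.rhoF ∈ FP :=
  comp_mem_FP takeFn_mem_FP (fanoutFn_mem_FP uK_mem_FP (comp_mem_FP dropFn_mem_FP
    (fanoutFn_mem_FP (comp_mem_FP umulFn_mem_FP (fanoutFn_mem_FP tF1_mem_FP uK_mem_FP)) segIF_mem_FP)))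
/-- `bitF ∈ FP` for polynomial-time `A`. [folklore] -/
theorem bitF_mem_FP (hA : Ad.A.IsPolyTime schemeEnc encodeBool) : P.bitF Ad ∈ FP :=
  comp_mem_FP (rsFn_mem_FP hA) (fanoutFn_mem_FP schInF_mem_FP rhoF_mem_FP)
/-- `guardF ∈ FP`. [folklore] -/
theorem guardF_mem_FP : guardF ∈ FP :=
  comp_mem_FP (lenLeFn_mem_FP _) (fanoutFn_mem_FP (comp_mem_FP umulFn_mem_FP (fanoutFn_mem_FP uN_mem_FP tmF_mem_FP))
    (comp_mem_FP (cons_mem_FP true) cF_mem_FP))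
/-- `endF ∈ FP`. [folklore] -/
theorem endF_mem_FP : endF ∈ FP :=
  comp_mem_FP eqPairFn_mem_FP (fanoutFn_mem_FP (comp_mem_FP (cons_mem_FP true) tF1_mem_FP) tmF_mem_FP)
/-- `cnt2F ∈ FP`. [folklore] -/
theorem cnt2F_mem_FP (hA : Ad.A.IsPolyTime schemeEnc encodeBool) : P.cnt2F Ad ∈ FP :=
  iteFn_mem_FP (bitF_mem_FP hA) (comp_mem_FP (cons_mem_FP true) (nthF_mem_FP 2)) (nthF_mem_FP 2)
/-- `majF ∈ FP`. [folklore] -/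
theorem majF_mem_FP (hA : Ad.A.IsPolyTime schemeEnc encodeBool) : P.majF Ad ∈ FP :=
  comp_mem_FP (lenLeFn_mem_FP _) (fanoutFn_mem_FP (comp_mem_FP concatFn_mem_FP (fanoutFn_mem_FP (cnt2F_mem_FP hA) (cnt2F_mem_FP hA)))
    (comp_mem_FP (cons_mem_FP true) tmF_mem_FP))
/-- `cntNew ∈ FP`. [folklore] -/
theorem cntNew_mem_FP (hA : Ad.A.IsPolyTime schemeEnc encodeBool) : P.cntNew Ad ∈ FP :=
  iteFn_mem_FP guardF_mem_FP (iteFn_mem_FP endF_mem_FP (const_mem_FP _) (cnt2F_mem_FP hA)) (nthF_mem_FP 2)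
/-- `bitsNew ∈ FP`. [folklore] -/
theorem bitsNew_mem_FP (hA : Ad.A.IsPolyTime schemeEnc encodeBool) : P.bitsNew Ad ∈ FP :=
  iteFn_mem_FP guardF_mem_FP (iteFn_mem_FP endF_mem_FP (comp_mem_FP concatFn_mem_FP (fanoutFn_mem_FP (sndPow_mem_FP 2) (majF_mem_FP hA)))
    (sndPow_mem_FP 2)) (sndPow_mem_FP 2)
/-- `rbody ∈ FP`. [folklore] -/
theorem rbody_mem_FP (hA : Ad.A.IsPolyTime schemeEnc encodeBool) : P.rbody Ad ∈ FP :=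
  fanoutFn_mem_FP fstF_mem_FP (fanoutFn_mem_FP (comp_mem_FP (cons_mem_FP true) cF_mem_FP)
    (fanoutFn_mem_FP (cntNew_mem_FP hA) (bitsNew_mem_FP hA)))
/-- `init1F ∈ FP`. [folklore] -/
theorem init1F_mem_FP : init1F ∈ FP := fanoutFn_mem_FP OracleCompose.id_mem_FP (const_mem_FP _)

/-- **One round of the inverter is polynomial time**: `candFn ∈ FP` for polynomial-time `A`
(`128 |x₁|²` runs of an additively growing `FP` round, `iterate_mem_FP`). [Arora–Barak 2009,
§1.4.1, §7.4.1; Bogdanov–Trevisan 2006, proof of Claim 28] [folklore] -/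
theorem candFn_mem_FP (hA : Ad.A.IsPolyTime schemeEnc encodeBool) : P.candFn Ad ∈ FP :=
  comp_mem_FP (sndPow_mem_FP 2) (comp_mem_FP
    (iterate_mem_FP (rbody_mem_FP hA) 11 (fun S => length_rbody_le S) (128 * X ^ 2)) init1F_mem_FP)

end FP

end Params

end ImpagliazzoLevin

end Literature.Computability.Cryptography
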